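import Summits.AtomisticToContinuum.BoseEinsteinCondensation.Theorems.BECRewardDescentRewardChordBoundNumberOperator
import Summits.AtomisticToContinuum.BoseEinsteinCondensation.Theorems.BECRewardDescentRewardChordBoundModulusOfSimpleHelpers

/-!
# The `2 × 2` Temple/Feshbach bound around an invariant near-minimiser of the rewarded functional
# (crux `RewardChordBound`, stmt-AtomisticToContinuum-12876, stub `stub_modulusOfSimple`, helper file 3)

`core_bound`: at fixed `(N, L)` with `N = n + 1`, for the rewarded functional
`F_t(Φ) = E(Φ) + t(N - n₀(Φ))` and `R(s) = inf F_s`, an invariant `δ`-near-minimiser `Ψ` of `F_s`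
obeying the variance hypothesis `‖n̂₀Ψ‖² ≤ n₀(Ψ)² + V`, the invariant Ky-Fan gap `g` above `R(s)`, and
`0 < A ≤ (1 - √δ)(g - δ) - hN`, every invariant finite-energy trial state `Φ` satisfies
`F_(s±h)(Φ) ≥ R(s) ± h·dep(Ψ) - h² max(V,0)/A - √δ`. Proof: Gram–Schmidt `Φ = c₀Ψ + χ̃` inside the
invariant `C¹` class; `E`, the mass and `n₀` are Hermitian forms on `span{Ψ, χ̃}` (helper files 1–2);
the variational principle on the span, the Ky-Fan gap for the normalised `χ̃`, and the variance bound
for the polar form of `n₀` feed the real `2 × 2` algebra. Plus the real form of `F_t` at a trial state.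
All `[folklore]`; no definitions.
-/

noncomputable section

namespace Summit.AtomisticToContinuum.BoseEinsteinCondensation.Cruxes.RewardChordBound.Birth.ModulusOfSimple

open MeasureTheory Filter
open scoped ENNReal NNReal ComplexConjugate
open Literature.MathematicalPhysics.QuantumManyBody.BoseGas

/-! ### Utilities on periodic trial states and the rewarded functional -/

section Utilities

variable {n N : ℕ} {L : ℝ} {v : ℝ → ℝ≥0∞}

/-- **Real form of the rewarded functional** at a finite-energy trial state and a reward `t ≥ 0`:
`F_t(Ψ) = E(Ψ) + t (N - n₀(Ψ))`. [folklore] -/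
theorem toReal_rewarded_trialState (hL : 0 < L) (v : ℝ → ℝ≥0∞) {t : ℝ} (ht : 0 ≤ t)
    (Ψ : PeriodicTrialState N L) (hE : periodicEnergy v Ψ ≠ ⊤) :
    (periodicEnergy v Ψ + ENNReal.ofReal t * ((N : ℝ≥0∞) - condensateOccupation N L Ψ.ψ)).toReal =
      (periodicEnergy v Ψ).toReal + t * (N - (condensateOccupation N L Ψ.ψ).toReal) := by
  have hsub : (N : ℝ≥0∞) - condensateOccupation N L Ψ.ψ ≠ ⊤ := ENNReal.sub_ne_top (ENNReal.natCast_ne_top N)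
  have hle : condensateOccupation N L Ψ.ψ ≤ (N : ℝ≥0∞) := by
    have h := condensateOccupation_le_card_mul_lintegral hL Ψ.contDiff.continuous (N := N)
    rwa [Ψ.norm_eq, mul_one] at h
  rw [ENNReal.toReal_add hE (ENNReal.mul_ne_top ENNReal.ofReal_ne_top hsub), ENNReal.toReal_mul,
    ENNReal.toReal_ofReal ht, ENNReal.toReal_sub_of_le hle (ENNReal.natCast_ne_top N), ENNReal.toReal_natCast]

/-- A trial state whose rewarded functional is below a finite level has finite energy. [folklore] -/
theorem periodicEnergy_ne_top_of_rewarded_le {t : ℝ} {Ψ : PeriodicTrialState N L} {M : ℝ≥0∞}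
    (hM : M ≠ ⊤)
    (h : periodicEnergy v Ψ + ENNReal.ofReal t * ((N : ℝ≥0∞) - condensateOccupation N L Ψ.ψ) ≤ M) :
    periodicEnergy v Ψ ≠ ⊤ :=
  ne_top_of_le_ne_top hM (le_self_add.trans h)

end Utilities

/-! ### The core bound on the invariant span -/

section Core

variable {n : ℕ} {L : ℝ} {v : ℝ → ℝ≥0∞}

/-- **The `2 × 2` Temple/Feshbach bound around an invariant near-minimiser.** Fix `L > 0`, a
measurable `v`, rewards `0 ≤ s - h`, `0 ≤ h`, an invariant `δ`-near-minimiser `Ψ` of `F_s`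
(`0 < δ ≤ 1`, `δ ≤ g`) obeying the variance hypothesis `‖n̂₀Ψ‖² ≤ n₀(Ψ)² + V`, the invariant Ky-Fan
gap `g` above `R(s)`, and `0 < A ≤ (1 - √δ)(g - δ) - hN`. Then every invariant finite-energy trial
state `Φ` has `F_(s±h)(Φ) ≥ R(s) ± h·dep(Ψ) - h² max(V,0)/A - √δ`. [folklore] -/
theorem core_bound (hL : 0 < L) (hv : Measurable v) {s h g δ A V : ℝ} (hh : 0 ≤ h) (hsh : 0 ≤ s - h)
    (hδ0 : 0 < δ) (hδ1 : δ ≤ 1) (hδg : δ ≤ g) (hA : 0 < A)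
    (hAle : A ≤ (1 - Real.sqrt δ) * (g - δ) - h * (n + 1 : ℕ))
    (hR : (⨅ Ψ : PeriodicTrialState (n + 1) L, (periodicEnergy v Ψ +
        ENNReal.ofReal s * (((n + 1 : ℕ) : ℝ≥0∞) - condensateOccupation (n + 1) L Ψ.ψ))) ≠ ⊤)
    (hGAP : ∀ Φ₁ Φ₂ : PeriodicTrialState (n + 1) L,
      (∀ (X : Config (n + 1)) (t : EuclideanSpace ℝ (Fin 3)), Φ₁.ψ (fun i => X i + t) = Φ₁.ψ X) →
      (∀ (X : Config (n + 1)) (t : EuclideanSpace ℝ (Fin 3)), Φ₂.ψ (fun i => X i + t) = Φ₂.ψ X) →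
      (∫ X in cellN (n + 1) L, conj (Φ₁.ψ X) * Φ₂.ψ X) = 0 →
      2 * (⨅ Ψ : PeriodicTrialState (n + 1) L, (periodicEnergy v Ψ +
          ENNReal.ofReal s * (((n + 1 : ℕ) : ℝ≥0∞) - condensateOccupation (n + 1) L Ψ.ψ))) +
        ENNReal.ofReal g ≤
      (periodicEnergy v Φ₁ + ENNReal.ofReal s * (((n + 1 : ℕ) : ℝ≥0∞) - condensateOccupation (n + 1) L Φ₁.ψ)) +
        (periodicEnergy v Φ₂ + ENNReal.ofReal s * (((n + 1 : ℕ) : ℝ≥0∞) - condensateOccupation (n + 1) L Φ₂.ψ)))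
    (Ψ Φ : PeriodicTrialState (n + 1) L)
    (hΨinv : ∀ (X : Config (n + 1)) (t : EuclideanSpace ℝ (Fin 3)), Ψ.ψ (fun i => X i + t) = Ψ.ψ X)
    (hΦinv : ∀ (X : Config (n + 1)) (t : EuclideanSpace ℝ (Fin 3)), Φ.ψ (fun i => X i + t) = Φ.ψ X)
    (hΨδ : periodicEnergy v Ψ + ENNReal.ofReal s * (((n + 1 : ℕ) : ℝ≥0∞) - condensateOccupation (n + 1) L Ψ.ψ) ≤
      (⨅ Ψ : PeriodicTrialState (n + 1) L, (periodicEnergy v Ψ +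
        ENNReal.ofReal s * (((n + 1 : ℕ) : ℝ≥0∞) - condensateOccupation (n + 1) L Ψ.ψ))) + ENNReal.ofReal δ)
    (hVΨ : ENNReal.ofReal ((L ^ 3)⁻¹ ^ 2) * (∫⁻ X in cellN (n + 1) L,
      (‖∑ i : Fin (n + 1), ∫ y in cell L, Ψ.ψ (Function.update X i y)‖₊ : ℝ≥0∞) ^ 2) ≤
      condensateOccupation (n + 1) L Ψ.ψ ^ 2 + ENNReal.ofReal V)
    (hEΦ : periodicEnergy v Φ ≠ ⊤) :
    (⨅ Ψ : PeriodicTrialState (n + 1) L, (periodicEnergy v Ψ +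
        ENNReal.ofReal s * (((n + 1 : ℕ) : ℝ≥0∞) - condensateOccupation (n + 1) L Ψ.ψ))).toReal +
        h * ((n + 1 : ℕ) - (condensateOccupation (n + 1) L Ψ.ψ).toReal) - h ^ 2 * max V 0 / A - Real.sqrt δ ≤
      (periodicEnergy v Φ + ENNReal.ofReal (s + h) *
        (((n + 1 : ℕ) : ℝ≥0∞) - condensateOccupation (n + 1) L Φ.ψ)).toReal ∧
    (⨅ Ψ : PeriodicTrialState (n + 1) L, (periodicEnergy v Ψ +
        ENNReal.ofReal s * (((n + 1 : ℕ) : ℝ≥0∞) - condensateOccupation (n + 1) L Ψ.ψ))).toReal -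
        h * ((n + 1 : ℕ) - (condensateOccupation (n + 1) L Ψ.ψ).toReal) - h ^ 2 * max V 0 / A - Real.sqrt δ ≤
      (periodicEnergy v Φ + ENNReal.ofReal (s - h) *
        (((n + 1 : ℕ) : ℝ≥0∞) - condensateOccupation (n + 1) L Φ.ψ)).toReal := by
  -- finiteness and the reals
  set Rs := (⨅ Ψ : PeriodicTrialState (n + 1) L, (periodicEnergy v Ψ +
        ENNReal.ofReal s * (((n + 1 : ℕ) : ℝ≥0∞) - condensateOccupation (n + 1) L Ψ.ψ))) with hRs
  have hs0 : 0 ≤ s := by linarith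
  have hΨc : Continuous Ψ.ψ := Ψ.contDiff.continuous
  have hΦc : Continuous Φ.ψ := Φ.contDiff.continuous
  have hEΨ : periodicEnergy v Ψ ≠ ⊤ :=
    periodicEnergy_ne_top_of_rewarded_le (ENNReal.add_ne_top.2 ⟨hR, ENNReal.ofReal_ne_top⟩) hΨδ
  set r : ℝ := Rs.toReal with hr
  set Nr : ℝ := ((n + 1 : ℕ) : ℝ) with hNr
  set eΨ : ℝ := (periodicEnergy v Ψ).toReal with heΨ
  set eΦ : ℝ := (periodicEnergy v Φ).toReal with heΦ
  set νΨ : ℝ := (condensateOccupation (n + 1) L Ψ.ψ).toReal with hνΨ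
  set νΦ : ℝ := (condensateOccupation (n + 1) L Φ.ψ).toReal with hνΦ
  -- Gram–Schmidt inside the invariant class: `Φ = c₀Ψ + χ̃`, `χ̃ ⊥ Ψ`
  set c₀ : ℂ := ∫ X in cellN (n + 1) L, conj (Ψ.ψ X) * Φ.ψ X with hc₀def
  set χt : Config (n + 1) → ℂ := fun X => 1 * Φ.ψ X + (-c₀) * Ψ.ψ X with hχt
  have hχtC : ContDiff ℝ 1 χt := (contDiff_const.mul Φ.contDiff).add (contDiff_const.mul Ψ.contDiff)
  have hχtc : Continuous χt := hχtC.continuous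
  have hχtper : ∀ (X : Config (n + 1)) (i : Fin (n + 1)) (k : Fin 3),
      χt (X + Pi.single i (EuclideanSpace.single k L)) = χt X := fun X i k => by
    simp only [hχt, Φ.periodic, Ψ.periodic]
  have hχtsymm : ∀ (σ : Equiv.Perm (Fin (n + 1))) (X : Config (n + 1)), χt (X ∘ σ) = χt X :=
    fun σ X => by simp only [hχt, Φ.symm, Ψ.symm]
  have hχtinv : ∀ (X : Config (n + 1)) (t : EuclideanSpace ℝ (Fin 3)), χt (fun i => X i + t) = χt X :=
    fun X t => by simp only [hχt, hΦinv, hΨinv]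
  have hΦpt : ∀ X, c₀ * Ψ.ψ X + 1 * χt X = Φ.ψ X := fun X => by simp only [hχt]; ring
  have horth : ∫ X in cellN (n + 1) L, conj (Ψ.ψ X) * χt X = 0 := by
    have hi1 : IntegrableOn (fun X => conj (Ψ.ψ X) * Φ.ψ X) (cellN (n + 1) L) :=
      integrableOn_cellN (hΨc.star.mul hΦc) L
    have hi2 : IntegrableOn (fun X => (-c₀) * (conj (Ψ.ψ X) * Ψ.ψ X)) (cellN (n + 1) L) :=
      integrableOn_cellN (continuous_const.mul (hΨc.star.mul hΨc)) L
    have hprod : (fun X => conj (Ψ.ψ X) * χt X) =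
        fun X => conj (Ψ.ψ X) * Φ.ψ X + (-c₀) * (conj (Ψ.ψ X) * Ψ.ψ X) := by
      funext X; simp only [hχt]; ring
    rw [hprod, integral_add hi1 hi2, integral_const_mul, integral_cellN_conj_mul_self_trialState,
      ← hc₀def]
    ring
  -- masses
  have hΨm := memLp_two_cellN_of_continuous hΨc L
  have hχm := memLp_two_cellN_of_continuous hχtc L
  have hΨmass : ∫ X in cellN (n + 1) L, ‖Ψ.ψ X‖ ^ 2 = 1 := by
    rw [integral_norm_sq_eq_toReal hΨc.aestronglyMeasurable, Ψ.norm_eq, ENNReal.toReal_one]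
  have hΦmass : ∫ X in cellN (n + 1) L, ‖Φ.ψ X‖ ^ 2 = 1 := by
    rw [integral_norm_sq_eq_toReal hΦc.aestronglyMeasurable, Φ.norm_eq, ENNReal.toReal_one]
  set m : ℝ := ∫ X in cellN (n + 1) L, ‖χt X‖ ^ 2 with hm
  have hm0 : 0 ≤ m := integral_nonneg fun X => sq_nonneg _
  have hμ : ∀ a b : ℂ, ∫ X in cellN (n + 1) L, ‖a * Ψ.ψ X + b * χt X‖ ^ 2 = ‖a‖ ^ 2 + ‖b‖ ^ 2 * m := by
    intro a b
    rw [integral_norm_sq_const_mul_add_const_mul hΨm hχm a b, hΨmass, horth, mul_zero,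
      Complex.zero_re, mul_zero, add_zero, mul_one]
  have hc₀ : ‖c₀‖ ^ 2 = 1 - m := by
    have h := hμ c₀ 1
    simp only [hΦpt] at h
    rw [hΦmass, norm_one, one_pow, one_mul] at h
    linarith
  have hmlint : ∫⁻ X in cellN (n + 1) L, ((‖χt X‖₊ : ℝ≥0∞)) ^ 2 = ENNReal.ofReal m :=
    lintegral_cellN_nnnorm_sq_eq_ofReal L hχtc
  -- energies on the span
  have hEχ : (∫⁻ X in cellN (n + 1) L, (kineticDensity χt X +
      periodicInteraction v L X * ((‖χt X‖₊ : ℝ≥0∞)) ^ 2)) ≠ ⊤ :=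
    lintegral_energy_const_mul_add_const_mul_ne_top hv L Φ.contDiff Ψ.contDiff hEΦ hEΨ 1 (-c₀)
  set eχ : ℝ := (∫⁻ X in cellN (n + 1) L, (kineticDensity χt X +
      periodicInteraction v L X * ((‖χt X‖₊ : ℝ≥0∞)) ^ 2)).toReal with heχ
  obtain ⟨BE, hBE⟩ := exists_polar_lintegral_energy hv L Ψ.contDiff hχtC hEΨ hEχ
  have hEspan : ∀ a b : ℂ, (∫⁻ X in cellN (n + 1) L, (kineticDensity (fun Y => a * Ψ.ψ Y + b * χt Y) X +
      periodicInteraction v L X * ((‖a * Ψ.ψ X + b * χt X‖₊ : ℝ≥0∞)) ^ 2)) ≠ ⊤ := fun a b =>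
    lintegral_energy_const_mul_add_const_mul_ne_top hv L Ψ.contDiff hχtC hEΨ hEχ a b
  -- `n₀` on the span and the variance bound for its polar form
  set P : ℂ := ∫ Y in cellN n L, conj (modeAn L (constantMode L) Ψ.ψ Y) * modeAn L (constantMode L) χt Y
    with hP
  set νχ : ℝ := (condensateOccupation (n + 1) L χt).toReal with hνχ
  have hν : ∀ a b : ℂ, (condensateOccupation (n + 1) L (fun X => a * Ψ.ψ X + b * χt X)).toReal =
      ‖a‖ ^ 2 * νΨ + ‖b‖ ^ 2 * νχ + 2 * (conj a * b * P).re := fun a b =>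
    toReal_condensateOccupation_const_mul_add_const_mul hΨc hχtc a b
  have hPV : ‖P‖ ^ 2 ≤ m * max V 0 :=
    norm_sq_polar_condensate_le_of_variance hL hΨc hχtc Ψ.symm hχtsymm Ψ.norm_eq horth hVΨ
  have hνχ0 : 0 ≤ νχ := ENNReal.toReal_nonneg
  have hνχle : νχ ≤ Nr * m := by
    have h := condensateOccupation_le_card_mul_lintegral hL hχtc (N := n + 1)
    rw [hmlint] at h
    have h2 := ENNReal.toReal_mono (ENNReal.mul_ne_top (ENNReal.natCast_ne_top _) ENNReal.ofReal_ne_top) h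
    rwa [ENNReal.toReal_mul, ENNReal.toReal_natCast, ENNReal.toReal_ofReal hm0] at h2
  have hνΨ0 : 0 ≤ νΨ := ENNReal.toReal_nonneg
  have hνΨle : νΨ ≤ Nr := by
    have h := condensateOccupation_le_card_mul_lintegral hL hΨc (N := n + 1)
    rw [Ψ.norm_eq, mul_one] at h
    have h2 := ENNReal.toReal_mono (ENNReal.natCast_ne_top _) h
    rwa [ENNReal.toReal_natCast] at h2
  -- the polar form of `q = F_s` on the span
  have hre : ∀ t : ℂ, (t * (BE - (s : ℂ) * P)).re = (t * BE).re - s * (t * P).re := fun t => by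
    rw [mul_sub, Complex.sub_re, show t * ((s : ℂ) * P) = (s : ℂ) * (t * P) by ring, Complex.re_ofReal_mul]
  -- (i) the variational inequality on the span
  have hvar : ∀ t : ℂ, r * (1 + ‖t‖ ^ 2 * m) ≤ (eΨ + s * (Nr - νΨ)) + ‖t‖ ^ 2 * (eχ + s * (Nr * m - νχ)) +
      2 * (t * (BE - (s : ℂ) * P)).re := by
    intro t
    have hfC : ContDiff ℝ 1 (fun X => 1 * Ψ.ψ X + t * χt X) :=
      (contDiff_const.mul Ψ.contDiff).add (contDiff_const.mul hχtC)
    have hmass := hμ 1 t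
    rw [norm_one, one_pow] at hmass
    have hpos : (∫ X in cellN (n + 1) L, ‖1 * Ψ.ψ X + t * χt X‖ ^ 2) ≠ 0 := by
      rw [hmass]; positivity
    have h := toReal_iInf_rewarded_mul_integral_le hL v hs0 hfC
      (fun X i k => by simp only [Ψ.periodic, hχtper]) (fun σ X => by simp only [Ψ.symm, hχtsymm])
      hpos (hEspan 1 t)
    rw [hmass, hBE 1 t, hν 1 t] at h
    simp only [norm_one, one_pow, one_mul, map_one] at h
    have h' : r * (1 + ‖t‖ ^ 2 * m) ≤ eΨ + ‖t‖ ^ 2 * eχ + 2 * (t * BE).re +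
        s * (Nr * (1 + ‖t‖ ^ 2 * m) - (νΨ + ‖t‖ ^ 2 * νχ + 2 * (t * P).re)) := h
    rw [hre]
    linarith [h']
  -- (ii) `q(Ψ) ≤ r + δ`
  have hqΨ : eΨ + s * (Nr - νΨ) ≤ r + δ := by
    have h := ENNReal.toReal_mono (ENNReal.add_ne_top.2 ⟨hR, ENNReal.ofReal_ne_top⟩) hΨδ
    rwa [toReal_rewarded_trialState hL v hs0 Ψ hEΨ, ENNReal.toReal_add hR ENNReal.ofReal_ne_top,
      ENNReal.toReal_ofReal hδ0.le] at h
  -- (iii) `q(χ̃) ≥ (r + g - δ) m` from the invariant Ky-Fan gap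
  have hqχ : (r + g - δ) * m ≤ eχ + s * (Nr * m - νχ) := by
    rcases hm0.eq_or_lt with hm00 | hmpos
    · have hν0 : νχ = 0 := le_antisymm (by rw [← hm00, mul_zero] at hνχle; exact hνχle) hνχ0
      rw [← hm00, hν0]
      have : 0 ≤ eχ := ENNReal.toReal_nonneg
      nlinarith
    have h0 : ∫⁻ X in cellN (n + 1) L, ((‖χt X‖₊ : ℝ≥0∞)) ^ 2 ≠ 0 := by
      rw [hmlint]; exact (ENNReal.ofReal_pos.2 hmpos).ne'
    have htop : ∫⁻ X in cellN (n + 1) L, ((‖χt X‖₊ : ℝ≥0∞)) ^ 2 ≠ ⊤ := by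
      rw [hmlint]; exact ENNReal.ofReal_ne_top
    obtain ⟨χ, a, hχψ, ha⟩ := exists_periodicTrialState_const_mul hχtC hχtper hχtsymm h0 htop
    rw [hmlint] at ha
    have hχinv : ∀ (X : Config (n + 1)) (t : EuclideanSpace ℝ (Fin 3)), χ.ψ (fun i => X i + t) = χ.ψ X :=
      fun X t => by simp only [hχψ, hχtinv]
    have horthχ : ∫ X in cellN (n + 1) L, conj (Ψ.ψ X) * χ.ψ X = 0 := by
      have hprod : (fun X => conj (Ψ.ψ X) * χ.ψ X) = fun X => (a : ℂ) * (conj (Ψ.ψ X) * χt X) := by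
        funext X; rw [hχψ]; ring
      rw [hprod, integral_const_mul, horth, mul_zero]
    have hG := hGAP Ψ χ hΨinv hχinv horthχ
    have hEχ' : periodicEnergy v χ = (ENNReal.ofReal m)⁻¹ * ∫⁻ X in cellN (n + 1) L, (kineticDensity χt X +
        periodicInteraction v L X * ((‖χt X‖₊ : ℝ≥0∞)) ^ 2) := by
      unfold periodicEnergy
      simp only [hχψ]
      rw [lintegral_periodicEnergy_const_mul v L (a : ℂ) hχtC, ha]
    have hnχ' : condensateOccupation (n + 1) L χ.ψ = (ENNReal.ofReal m)⁻¹ * condensateOccupation (n + 1) L χt := by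
      rw [hχψ, condensateOccupation_const_mul, ha]
    have hinv : (ENNReal.ofReal m)⁻¹ ≠ ⊤ := ENNReal.inv_ne_top.2 (ENNReal.ofReal_pos.2 hmpos).ne'
    have hEχtop : periodicEnergy v χ ≠ ⊤ := by rw [hEχ']; exact ENNReal.mul_ne_top hinv hEχ
    have hFΨtop : periodicEnergy v Ψ + ENNReal.ofReal s *
        (((n + 1 : ℕ) : ℝ≥0∞) - condensateOccupation (n + 1) L Ψ.ψ) ≠ ⊤ :=
      ENNReal.add_ne_top.2 ⟨hEΨ, ENNReal.mul_ne_top ENNReal.ofReal_ne_top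
        (ENNReal.sub_ne_top (ENNReal.natCast_ne_top _))⟩
    have hFχtop : periodicEnergy v χ + ENNReal.ofReal s *
        (((n + 1 : ℕ) : ℝ≥0∞) - condensateOccupation (n + 1) L χ.ψ) ≠ ⊤ :=
      ENNReal.add_ne_top.2 ⟨hEχtop, ENNReal.mul_ne_top ENNReal.ofReal_ne_top
        (ENNReal.sub_ne_top (ENNReal.natCast_ne_top _))⟩
    have h := ENNReal.toReal_mono (ENNReal.add_ne_top.2 ⟨hFΨtop, hFχtop⟩) hG
    rw [ENNReal.toReal_add (ENNReal.mul_ne_top ENNReal.ofNat_ne_top hR) ENNReal.ofReal_ne_top,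
      ENNReal.toReal_mul, ENNReal.toReal_ofNat, ENNReal.toReal_ofReal (hδ0.le.trans hδg),
      ENNReal.toReal_add hFΨtop hFχtop, toReal_rewarded_trialState hL v hs0 Ψ hEΨ,
      toReal_rewarded_trialState hL v hs0 χ hEχtop, hEχ', hnχ', ENNReal.toReal_mul, ENNReal.toReal_mul,
      ENNReal.toReal_inv, ENNReal.toReal_ofReal hm0] at h
    have hqΨm : (eΨ + s * (Nr - νΨ)) * m ≤ (r + δ) * m := mul_le_mul_of_nonneg_right hqΨ hm0
    have key : (2 * r + g) * m ≤ (eΨ + s * (Nr - νΨ)) * m + eχ + s * (Nr * m - νχ) := by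
      calc (2 * r + g) * m ≤ ((eΨ + s * (Nr - νΨ)) + (m⁻¹ * eχ + s * (Nr - m⁻¹ * νχ))) * m :=
            mul_le_mul_of_nonneg_right h hm0
        _ = _ := by field_simp; ring
    nlinarith [key, hqΨm]
  -- (iv) the value at `Φ = c₀Ψ + χ̃`
  have heΦ' : eΦ = ‖c₀‖ ^ 2 * eΨ + eχ + 2 * (conj c₀ * BE).re := by
    have h := hBE c₀ 1
    simp only [hΦpt] at h
    rw [norm_one, one_pow, one_mul, mul_one] at h
    exact h
  have hνΦ' : νΦ = ‖c₀‖ ^ 2 * νΨ + νχ + 2 * (conj c₀ * P).re := by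
    have h := hν c₀ 1
    simp only [hΦpt] at h
    rw [norm_one, one_pow, one_mul, mul_one] at h
    exact h
  have hRq := hre (conj c₀)
  have hqΦ : eΦ + s * (Nr - νΦ) = ‖c₀‖ ^ 2 * (eΨ + s * (Nr - νΨ)) + (eχ + s * (Nr * m - νχ)) +
      2 * (conj c₀ * (BE - (s : ℂ) * P)).re := by
    linear_combination heΦ' - s * hνΦ' - 2 * hRq - s * Nr * hc₀
  -- (v) the depletion form
  have hnegre : (conj c₀ * -P).re = -(conj c₀ * P).re := by rw [mul_neg, Complex.neg_re]
  have hdΦ : Nr - νΦ = ‖c₀‖ ^ 2 * (Nr - νΨ) + (Nr * m - νχ) + 2 * (conj c₀ * -P).re := by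
    linear_combination -hνΦ' - Nr * hc₀ - 2 * hnegre
  -- (vi) the two-level algebra and the conclusion
  have hq := form_lower_bound_on_span hδ0 hδ1 hδg hm0 hc₀ hvar hqΨ hqχ hqΦ
  have hD : ‖-P‖ ^ 2 ≤ m * max V 0 := by rwa [norm_neg]
  obtain ⟨hplus, hminus⟩ := rewarded_lower_bounds_on_span hq hm0 hc₀ hdΦ hD (le_max_right _ _)
    (by linarith) (by linarith) (by linarith) (by linarith) hh hA hAle
  have hF1 : (periodicEnergy v Φ + ENNReal.ofReal (s + h) *
      (((n + 1 : ℕ) : ℝ≥0∞) - condensateOccupation (n + 1) L Φ.ψ)).toReal = eΦ + (s + h) * (Nr - νΦ) :=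
    toReal_rewarded_trialState hL v (by linarith) Φ hEΦ
  have hF2 : (periodicEnergy v Φ + ENNReal.ofReal (s - h) *
      (((n + 1 : ℕ) : ℝ≥0∞) - condensateOccupation (n + 1) L Φ.ψ)).toReal = eΦ + (s - h) * (Nr - νΦ) :=
    toReal_rewarded_trialState hL v hsh Φ hEΦ
  rw [hF1, hF2]
  constructor <;> linarith [hplus, hminus]

end Core

end Summit.AtomisticToContinuum.BoseEinsteinCondensation.Cruxes.RewardChordBound.Birth.ModulusOfSimple

namespace Summit.AtomisticToContinuum.BoseEinsteinCondensation.Cruxes.RewardChordBound.Birth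

/-- **Registered sub-goal of stub `stub_modulusOfSimple` (helper file 3): the `2 × 2` Temple/Feshbach bound
around an invariant near-minimiser** (`ModulusOfSimple.core_bound`, reward infimum abstracted as `R`). [folklore] -/
theorem stub_modulusOfSimpleCoreBound :
    ∀ (v : ℝ → ENNReal) (n : ℕ) (L s h g δ A V : ℝ) (R : ENNReal), R = (⨅ Ψ : Literature.MathematicalPhysics.QuantumManyBody.BoseGas.PeriodicTrialState (n + 1) L, (Literature.MathematicalPhysics.QuantumManyBody.BoseGas.periodicEnergy v Ψ + ENNReal.ofReal s * (((n + 1 : ℕ) : ENNReal) - Literature.MathematicalPhysics.QuantumManyBody.BoseGas.condensateOccupation (n + 1) L Ψ.ψ))) → 0 < L → Measurable v → 0 ≤ h → 0 ≤ s - h → 0 < δ → δ ≤ 1 → δ ≤ g → 0 < A → A ≤ (1 - Real.sqrt δ) * (g - δ) - h * (n + 1 : ℕ) → R ≠ ⊤ → (∀ Φ₁ Φ₂ : Literature.MathematicalPhysics.QuantumManyBody.BoseGas.PeriodicTrialState (n + 1) L, (∀ (X : Literature.MathematicalPhysics.QuantumManyBody.BoseGas.Config (n + 1)) (t : EuclideanSpace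 ℝ (Fin 3)), Φ₁.ψ (fun i => X i + t) = Φ₁.ψ X) → (∀ (X : Literature.MathematicalPhysics.QuantumManyBody.BoseGas.Config (n + 1)) (t : EuclideanSpace ℝ (Fin 3)), Φ₂.ψ (fun i => X i + t) = Φ₂.ψ X) → (∫ X in Literature.MathematicalPhysics.QuantumManyBody.BoseGas.cellN (n + 1) L, starRingEnd ℂ (Φ₁.ψ X) * Φ₂.ψ X) = 0 → 2 * R + ENNReal.ofReal g ≤ (Literature.MathematicalPhysics.QuantumManyBody.BoseGas.periodicEnergy v Φ₁ + ENNReal.ofReal s * (((n + 1 : ℕ) : ENNReal) - Literature.MathematicalPhysics.QuantumManyBody.BoseGas.condensateOccupation (n + 1) L Φ₁.ψ)) + (Literature.MathematicalPhysics.QuantumManyBody.BoseGas.periodicEnergy v Φ₂ + ENNReal.ofReal s * (((n + 1 : ℕ) : ENNReal) - Literature.MathematicalPhysics.QuantumManyBody.BoseGas.condensateOccupation (n + 1) L Φ₂.ψ))) → ∀ Ψ Φ : Literature.MathematicalPhysics.QuantumManyBody.BoseGas.PeriodicTrialState (n + 1) L, (∀ (X : Literature.MathematicalPhysics.QuantumManyBody.BoseGas.Config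 (n + 1)) (t : EuclideanSpace ℝ (Fin 3)), Ψ.ψ (fun i => X i + t) = Ψ.ψ X) → (∀ (X : Literature.MathematicalPhysics.QuantumManyBody.BoseGas.Config (n + 1)) (t : EuclideanSpace ℝ (Fin 3)), Φ.ψ (fun i => X i + t) = Φ.ψ X) → Literature.MathematicalPhysics.QuantumManyBody.BoseGas.periodicEnergy v Ψ + ENNReal.ofReal s * (((n + 1 : ℕ) : ENNReal) - Literature.MathematicalPhysics.QuantumManyBody.BoseGas.condensateOccupation (n + 1) L Ψ.ψ) ≤ R + ENNReal.ofReal δ → ENNReal.ofReal ((L ^ 3)⁻¹ ^ 2) * (∫⁻ X in Literature.MathematicalPhysics.QuantumManyBody.BoseGas.cellN (n + 1) L, (‖∑ i : Fin (n + 1), ∫ y in Literature.MathematicalPhysics.QuantumManyBody.BoseGas.cell L, Ψ.ψ (Function.update X i y)‖₊ : ENNReal) ^ 2) ≤ Literature.MathematicalPhysics.QuantumManyBody.BoseGas.condensateOccupation (n + 1) L Ψ.ψ ^ 2 + ENNReal.ofReal V → Literature.MathematicalPhysics.QuantumManyBody.BoseGas.periodicEnergy v Φ ≠ ⊤ → R.toReal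 + h * ((n + 1 : ℕ) - (Literature.MathematicalPhysics.QuantumManyBody.BoseGas.condensateOccupation (n + 1) L Ψ.ψ).toReal) - h ^ 2 * max V 0 / A - Real.sqrt δ ≤ (Literature.MathematicalPhysics.QuantumManyBody.BoseGas.periodicEnergy v Φ + ENNReal.ofReal (s + h) * (((n + 1 : ℕ) : ENNReal) - Literature.MathematicalPhysics.QuantumManyBody.BoseGas.condensateOccupation (n + 1) L Φ.ψ)).toReal ∧ R.toReal - h * ((n + 1 : ℕ) - (Literature.MathematicalPhysics.QuantumManyBody.BoseGas.condensateOccupation (n + 1) L Ψ.ψ).toReal) - h ^ 2 * max V 0 / A - Real.sqrt δ ≤ (Literature.MathematicalPhysics.QuantumManyBody.BoseGas.periodicEnergy v Φ + ENNReal.ofReal (s - h) * (((n + 1 : ℕ) : ENNReal) - Literature.MathematicalPhysics.QuantumManyBody.BoseGas.condensateOccupation (n + 1) L Φ.ψ)).toReal :=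
  fun _ _ _ _ _ _ _ _ _ _ hRdef hL hv hh hsh hδ0 hδ1 hδg hA hAle hR hGAP Ψ Φ hΨinv hΦinv hΨδ hVΨ hEΦ => by
    subst hRdef
    exact ModulusOfSimple.core_bound hL hv hh hsh hδ0 hδ1 hδg hA hAle hR hGAP Ψ Φ hΨinv hΦinv hΨδ hVΨ hEΦ

end Summit.AtomisticToContinuum.BoseEinsteinCondensation.Cruxes.RewardChordBound.Birth

end
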